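import Literature.AlgebraicGeometry.Deformation.CurvilinearObstructionsDoNotGenerate
import Literature.AlgebraicGeometry.Deformation.ObstructionSpaceDimensionBound
import Mathlib.RingTheory.Spectrum.Prime.RingHom
import Mathlib.RingTheory.PowerSeries.Order
import HarnessLib

/-!
# «Hence it is enough to prove `h ≤ dim T^{2c}_R`»: [FM99] Proposition 2.5, the proof AS PRINTED modulo the curve
# selection lemma 2.4 — curvilinear obstructions induced by a triangular system of arcs are linearly independent,
# and `dim R ≥ dim T¹_R − dim T^{2c}_R` follows by Krull's height theorem; Lemma 0.3 «canonically»: the embedding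
# `T²_R ↪ T²` is compatible with ALL obstruction maps (universality of `(T²_R, l_•)`); hence Theorem 2.2 for a
# functor with a smooth `h_R → F`, modulo Lemma 2.4 alone

Family `hodge` (computation cell `pub-hsemireg`, LIT-W seat «Kawamata ∕ Ran T¹-lifting as printed»), layer
`Literature/AlgebraicGeometry/Deformation`, on top of `CurvilinearObstructionsDoNotGenerate.lean` (Def. 3.5
`ArtinFunctor.ObstructionSpace.curvilinearObstructions`; [FM98, Lemma 5.5] with arcs `w : P → k[[t]]`,
`ProRep.mem_curvilinearObstructions_iff_exists_powerSeries_arc`; the model `T²_R = (I/𝔪_P I)^∨` with its obstruction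
maps `l_f`, `ArtinFunctor.powerSeriesPointsObstructionSpace`, `ProRep.IModMI` ∕ `cls` ∕ `mI`; [FM99, Ex. 2.3] = the failure
of Thm. 2.2 over `ℝ`, `FM99Example23.*`) and `ObstructionSpaceDimensionBound.lean` (Krull's height theorem for
`P = k[[x_1, …, x_n]]`: `ProRep.powerSeries_le_ringKrullDim_quotient_add_card`, `n ≤ dim P/(f_1, …, f_t) + t`;
`ProRep.powerSeries_spanFinrank_maximalIdeal_quotient_eq`, `emb dim P/I = n` for `I ⊆ 𝔪²`; its HONEST SCOPE (3) names
[FM99, Thm. 2.2] «the curvilinear refinement — NOT typed here»; it imports `CompatibleObstructionTheories.lean`: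
`ArtinFunctor.ObstructionTheory.comap`, `comap_isComplete_of_isSmoothMapSmall`, `IsNatural`, `IsSmoothMapSmall`) and, through
them, `T1LiftingAuxiliaryAlgebras.lean` ([FM99, Lemma 0.3]: `ArtinFunctor.pointsObstructionSpace`, `ProRep.dualTensorHom_ob`,
the truncations `ProRep.IsTruncation` ∕ `uJ` ∕ `aJ` ∕ `kerEquivJ` ∕ `toObstructionSpaceJ` ∕ `toObstructionSpaceJ_eq_of_le` ∕
`powerSeries_toObstructionSpaceJ_injective` of [Har10, Thm. 11.1], whose HONEST SCOPE names «the universality of `u_R`» as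
NOT typed — §6 below types it in Def. 0.1's language), with Mathlib's `Ideal.primeSpectrumQuotientOrderIsoZeroLocus`
(`Spec R/I ≅ V(I)`) and `PowerSeries.order`. THEOREMS only (no definition, no named fact, no `sorry`).

## Source, verbatim ([FantechiManetti1999T1Lifting] = B. Fantechi, M. Manetti, «On the T¹-lifting theorem»,
## J. Algebraic Geom. 8 (1999) 31–39; authors' version (store paper:url-0ad0608bb44b, 7 pp.), §2 «Dimension of local
## moduli», p. 5 bottom – p. 6, read by eye on the renders HOME/lit/FantechiManetti1999-T1Lifting-AuthorVersion-litw-g6/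
## renders/fm99_p5_bot.png, fm99_p6_top.png; journal pages 31–39 unseen, acq-10203)

p. 5: «In the paper [Ran2] Ran gave an estimate on the dimension of some Hilbert schemes using deformation theory
arguments. In [Kaw2] Kawamata raised some objections to Ran's proof and gave a new proof.
DEFINITION 2.1. Let `F` be a deformation-type functor, and let `v ∈ T²_F`. We say that `v` is a curvilinear
obstruction if `v ⊗ tⁿ` is in the image of `ob_{φ_n}` for some `n ∈ ℕ`, where `φ_n : k[t]/t^{n+1} → k[t]/tⁿ` is the
obvious map.
THEOREM 2.2. Let `F` be a deformation functor, and let `T^{2c}_F` be the vector subspace of `T²_F` generated by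
curvilinear obstructions. If `k` is algebraically closed, then the dimension of the hull of `F` is
`≥ dim T¹_F − dim T^{2c}_F`.
EXAMPLE 2.3. If `k` is not algebraically closed then theorem 2.2 may fail. …»
p. 6: «LEMMA 2.4. Let `k` be an algebraically closed field. Let `R ∈ Ârt_k`, and `g ∈ 𝔪_R` a non-nilpotent element.
Then there is a local homomorphism `ψ : R → k[[t]]` such that `ψ(g) ≠ 0`.
Proof. As `g = 0` is a proper subset of `Spec R`, there is a curve in `Spec R` not contained in it. For a detailed proof,
see [FM1], Lemma 5.4. □
PROPOSITION 2.5. Let `R ∈ Ârt_k`, and assume `k = k̄`. Let `T^{2c}_R` be the vector subspace of `T²_R` generated by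
curvilinear obstructions. Then `dim R ≥ dim T¹_R − dim T^{2c}_R`.
Proof. Write `R = P/I`, with `P` a power series algebra and `I ⊂ 𝔪²_P`. Let `d = dim T²_R = dim(I/𝔪I)`. By Nakayama's
lemma, `I` can be generated by `d` elements, say `I = (f_1, …, f_d)`. As `k` is algebraically closed, by repeated
application of lemma 2.4 (and possibly reordering the `f_i`'s) we can assume that there exists an `h ≤ d` such that the
following holds:
1) `f_i ∉ √(f_1, …, f_{i−1})` for `i ≤ h`;
2) for all `i ≤ h` there exists a morphism `φ_i : P → k[[t]]` in `Ârt_k` such that `φ_i(f_i) ≠ 0`, `φ_i(f_j) = 0` if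
`j < i` and `deg φ_i(f_j) ≥ deg φ_i(f_i)` if `j > i`;
3) `I ⊂ √(f_1, …, f_h)`.
Condition 3) implies that `dim R = dim P/(f_1, …, f_h)`, hence it is enough to prove `h ≤ dim T^{2c}_R`. For
`i = 1, …, h`, let `v_i ∈ T^{2c}_R` be the obstruction induced by `φ_i`. Then, since `f_1, …, f_d` are linearly
independent in `I/𝔪I`, the elements `v_1, …, v_h` are also linearly independent in `(I/𝔪I)^∨`, as the associated
matrix contains a triangular `h × h` minor with nonzero elements on the diagonal. □
Proof of theorem 2.2. Let `h_R → F` be a smooth morphism (that is, `R` is a hull for `F`). Then `T²_F` is naturally an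
obstruction space for `h_R`, hence by 0.3 it contains `T²_R` as a vector subspace and `T^{2c}_F = T^{2c}_R`. The theorem
follows from proposition 2.5. □
REMARK 2.6. Kawamata's proof of theorem 2.2 also uses the assumption `k = k̄`, although this is not explicitly stated.
In [Kaw2], Kawamata considers functors on `Art_Λ`, where `Λ` is a local complete noetherian `k`-algebra. Our proof can be
easily adapted to this more general situation, with minor changes.»

## What this file proves (`P = k[[x_1, …, x_n]] = MvPowerSeries (Fin n) k`, `𝔪 = 𝔪_P`, `I ⊆ 𝔪²`, `R = P/I`,
## `T²_R = (I/𝔪I)^∨` with the obstruction maps `l_•` (`ArtinFunctor.powerSeriesPointsObstructionSpace`), `T^{2c}_R` :=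
## the `k`-span of its curvilinear obstructions (Def. 3.5 ∕ Def. 2.1), `dim = ringKrullDim`; ANY field `k`)

* §0 `ProRep.linearIndependent_of_apply_triangular` — «a triangular `h × h` minor with nonzero elements on the
  diagonal»: functionals `v_i` and vectors `x_j` with `v_i(x_j) = 0` (`j < i`), `v_i(x_i) ≠ 0` ⇒ the `v_i` are linearly
  independent (evaluate a relation at `x_1, x_2, …`).
* §1 `ProRep.constantCoeff_arc_apply_eq_zero` (private; every `k`-algebra map `P → k[[t]]` is local — print's
  «in `Ârt_k`»), `ProRep.coeff_arc_apply_mul_eq_zero`, and **`ProRep.exists_curvilinearObstruction_of_arc`** — «the obstruction induced by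
  `φ_i`»: for an arc `w : P → k[[t]]` with `w(I) ⊆ (t^p)`, `p ≥ 1`, the functional `[g] ↦ (t^p-coefficient of w(g))`
  on `I/𝔪I` is well defined (it kills `𝔪I`) and is a curvilinear obstruction of `(T²_R, l_•)` — [FM98, Lemma 5.5] in
  the tree's form `ProRep.mem_curvilinearObstructions_iff_exists_powerSeries_arc` (scalar `c = 1`).
* §2 **`ProRep.le_finrank_span_curvilinearObstructions_of_arcs`** — THE PRINTED STEP «it is enough to prove
  `h ≤ dim T^{2c}_R` … linearly independent … triangular minor»: given `f_1, …, f_h ∈ I` and arcs `φ_i` with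
  `φ_i(I) ⊆ (t^{p_i})`, `φ_i(f_j) = 0` for `j < i`, `(t^{p_i}-coeff of φ_i(f_i)) ≠ 0`, the induced obstructions are
  linearly independent and `h ≤ dim_k T^{2c}_R`; **`ProRep.le_finrank_span_curvilinearObstructions_of_printedArcs`** —
  the same from CONDITION 2) VERBATIM (`I = (f_1, …, f_d)`, `h ≤ d`, `φ_i(f_i) ≠ 0`, `φ_i(f_j) = 0` for `j < i`,
  `deg φ_i(f_j) ≥ deg φ_i(f_i)` for `j > i`, `deg` = `PowerSeries.order`), deriving `φ_i(I) ⊆ (t^{deg φ_i(f_i)})`.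
* §3 `ProRep.ringKrullDim_quotient_eq_of_le_of_le_radical` (`J ⊆ I ⊆ √J ⇒ dim A/I = dim A/J`, any commutative ring:
  `Spec A/I ≅ V(I) = V(J)`) and `ProRep.ringKrullDim_quotient_eq_of_le_radical_span` — «Condition 3) implies that
  `dim R = dim P/(f_1, …, f_h)`».
* §4 **`ProRep.powerSeries_le_ringKrullDim_add_finrank_span_curvilinearObstructions_of_arcs`** — PROPOSITION 2.5 ASSEMBLED
  MODULO LEMMA 2.4: from the data `f_1, …, f_h ∈ I`, 3) `I ⊆ √(f_1, …, f_h)` and arcs as in 2),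
  `n ≤ dim R + dim_k T^{2c}_R` («`dim R ≥ dim T¹_R − dim T^{2c}_R`», `n = dim T¹_R`) — by Krull
  (`n ≤ dim P/(f_1, …, f_h) + h`, [Matsumura1987, Thm. 13.6 (ii)] = the tree's
  `ProRep.powerSeries_le_ringKrullDim_quotient_add_card`), §3 and §2; `…exists_ringKrullDim_eq_le_add…` — in `ℕ`;
  `ProRep.powerSeries_spanFinrank_maximalIdeal_le_ringKrullDim_add_finrank_span_curvilinearObstructions_of_arcs` — with
  `dim T¹_R` read as the embedding dimension `μ(𝔪_R) = n` ([FM98, Def. 5.1] «the embedding dimension of `R`»; the tree's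
  `ProRep.powerSeries_spanFinrank_maximalIdeal_quotient_eq`).
* §5 `ProRep.image_curvilinearObstructions_subset_of_compatible` — «`T^{2c}_F = T^{2c}_R`», the inclusion `⊇`: for ANY
  two functors of Artin rings with obstruction spaces `(T, ob^F)`, `(W, ob^G)`, maps `ν_A : F(A) → G(A)` and a linear
  `θ : T → W` compatible with the obstruction maps of the curvilinear extensions `e_N`, `θ` carries curvilinear
  obstructions to curvilinear obstructions; `ProRep.curvilinearObstructions_subset_image_of_compatible` ∕
  `ProRep.image_curvilinearObstructions_eq_of_compatible` — the inclusion `⊆` and the EQUALITY when the `ν_{A_N}` are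
  surjective (as for a hull); `ProRep.finrank_span_curvilinearObstructions_le_of_compatible` — for `θ`
  injective, `dim T^{2c}` does not drop; **`ProRep.powerSeries_le_ringKrullDim_add_finrank_span_curvilinearObstructions_of_compatible_of_arcs`**
  — THEOREM 2.2's PRINTED DEDUCTION «The theorem follows from proposition 2.5»: with an injective compatible
  `θ : T²_R → W` (the two outputs of «by 0.3 it contains `T²_R` as a vector subspace», as HYPOTHESES) and Prop. 2.5's
  data, `n ≤ dim R + dim_k T^{2c}_F`.
* §6 **`ProRep.rTensor_toObstructionSpaceJ_ob`** — LEMMA 0.3 «CANONICALLY» = THE UNIVERSALITY OF `(T²_R, l_•)` ([FM98,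
  Prop. 5.3 (iii)] in Def. 0.1's language), abstract form: for `R = P/I`, `I ⊆ 𝔪²`, a truncation `u : P/J₁ → P/J₂` of the
  universal extension ([Har10, Thm. 11.1], `ProRep.IsTruncation`), ANY obstruction space `(T², ob′)` of `h_R` and its
  canonical `θ = ProRep.toObstructionSpaceJ`: `ob′_p(a) = (θ ⊗ K(p))(ob_p(a))` for every small extension `p : B → A` of
  `Art_k`, `a ∈ h_R(A)` and lifting `φ : P → B` of `a` killing `J₁` (Def. 0.1 (ii) along `(φ̄, ā) : u → p` + the tensor
  identity `rTensor_eq_lTensor_dualTensorHom`); **`ProRep.powerSeries_rTensor_toObstructionSpaceJ_ob`** — for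
  `P = k[[x_1, …, x_n]]` and EVERY small extension of `Art_k` (no hypothesis on `φ`: `𝔪_B` is nilpotent, and `θ` does not
  depend on the truncation, `toObstructionSpaceJ_eq_of_le`), with `θ` the very map of
  `ProRep.powerSeries_toObstructionSpaceJ_injective`.
* §7 **`ProRep.powerSeries_le_ringKrullDim_add_finrank_span_curvilinearObstructions_of_isSmoothMapSmall_of_arcs`** —
  THEOREM 2.2 FOR A FUNCTOR `F` WITH A SMOOTH `ν : h_R → F` (natural, smooth on small extensions) and a finite-dimensional
  obstruction space `(T²_F, ob^F)`, MODULO LEMMA 2.4 ALONE: from Prop. 2.5's data for `R`, `n ≤ dim R + dim_k T^{2c}_F` —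
  every printed step a tree theorem: «`T²_F` is naturally an obstruction space for `h_R`» (VIII's `comap`), «by 0.3 it
  contains `T²_R`» (VII's injectivity), «`T^{2c}_F = T^{2c}_R`» (`⊇`: §6 + §5), «follows from proposition 2.5» (§4);
  `ProRep.powerSeries_exists_injective_image_curvilinearObstructions_eq` — «by 0.3 it contains `T²_R` as a vector
  subspace and `T^{2c}_F = T^{2c}_R`» AS PRINTED (an injective `θ` under which the two sets of curvilinear obstructions
  correspond exactly) when moreover the `ν_{A_N}` are surjective.

HONEST SCOPE. (1) LEMMA 2.4 (curve selection; = [FM98, Lemma 5.4], «normalisation of complete local domains ∕ Weierstrass»)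
is NOT typed: conditions 2)–3) of the printed proof are HYPOTHESES here (the arcs `φ_i` and the radical inclusion are
data), and condition 1) — used in print only to construct the `φ_i` — is dropped. Consequently every statement holds
over ANY field `k`; the hypothesis `k = k̄` of Prop. 2.5 is exactly what produces the data, and without it the data need
not exist: over `k = ℝ`, `R = ℝ[[x, y]]/(x³, y³, x² + y²)` has `dim R = 0 < dim T¹_R − dim T^{2c}_R = 2 − 1` ([FM99, Ex. 2.3],
the tree's `FM99Example23.ringKrullDim_quotient` ∕ `finrank_cotangentSpace` ∕ `finrank_span_curvilinearObstructions`).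
(2) «By Nakayama's lemma, `I` can be generated by `d` elements» (`d = dim (I/𝔪I)`) is the tree's
`ProRep.exists_finset_span_eq_card_le_finrank` (`ObstructionSpaceEquationCount.lean`, [Matsumura1987, Thm. 2.3 (i)]) and
is not needed for the typed step (any `f_1, …, f_h ∈ I` with 2)–3) will do); the reordering is bookkeeping inside
Lemma 2.4's use; the remark «since `f_1, …, f_d` are linearly independent in `I/𝔪I`» is not used either (the independence
of the `v_i` follows from the triangular evaluations alone). (3) THEOREM 2.2 (deformation functors: «the dimension of the hull of `F`») is typed (§7) for a functor of
Artin rings `F` GIVEN WITH a morphism `ν : h_R → F`, `R = P/I`, natural and smooth on small extensions (the printed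
«`h_R → F` smooth, that is, `R` is a hull for `F`» minus the tangent bijection, which the proof does not use; the
EXISTENCE of a hull for a deformation functor — Schlessinger — is not re-typed here) and an obstruction space `(T²_F, ob^F)`
of FINITE dimension (`Module.Finite k W`, so that `dim T^{2c}_F` is a number), modulo Lemma 2.4 as in (1); of
«`T^{2c}_F = T^{2c}_R`» only the inclusion `⊇` (under `θ`) is used by the bound; the EQUALITY is typed separately
(`powerSeries_exists_injective_image_curvilinearObstructions_eq`) under the extra hypothesis that the `ν_{A_N}` are
surjective — which print gets from «`R` is a hull for `F`» (a smooth morphism from a hull is surjective on objects;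
VIII's `IsSmoothMap.surjective_of_surjective` needs a surjective start, i.e. `F(k) = ∗`, not assumed here). `T²_R` is the tree's model `(I/𝔪_P I)^∨`
with the maps `l_f` of [FM98, Lemma 5.2]; §6 proves that model UNIVERSAL among obstruction spaces of `h_R` in Def. 0.1's
sense (compatibility of 0.3's `θ` with every `ob′_p`) — the identification `T²_R = Ex(R, k)` itself is still not typed;
«curvilinear obstruction» is [FM98, Def. 3.5] in the model extensions `e_N : A_{N+1} → A_N` (= Def. 2.1's `φ_n`,
`n = N + 1`). Remark 2.6's relative form over `Art_Λ` is not typed. (4) `deg` of a power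
series is read as its order (`PowerSeries.order`, in `ℕ∞`; `deg 0 = ∞`), the only reading under which 2) is used in
the proof («`φ_i(I) ⊆ (t^{deg φ_i(f_i)})`»). (5) `dim R` is `ringKrullDim (P ⧸ I)` (in `WithBot ℕ∞`; a natural number
here, `ProRep.powerSeries_exists_ringKrullDim_quotient_eq`), `dim T¹_R = n` for `I ⊆ 𝔪²` (§4's last theorem makes the
embedding-dimension reading explicit), `dim T^{2c}_R = Module.finrank` of the span. Nothing in this file says that any
deformation functor, semiregularity map or Hodge-theoretic object of the cell has or lacks curvilinear obstructions, or
that any hull of the cell satisfies the bound; [Ran2] ∕ [Kaw2] of the quoted paragraph (= [Ran1993HodgeHilbertScheme] ∕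
[Kawamata1995UnobstructedDeformationsII]) are context only. Nothing here says HC ∕ HC_CM ∕ HC_AV is proved.

## References

* B. Fantechi, M. Manetti, *On the T¹-lifting theorem*, J. Algebraic Geom. 8 (1999) 31–39: §0 Def. 0.1, Lemma 0.3;
  §2, Def. 2.1, Thm. 2.2 with proof, Ex. 2.3, Lemma 2.4, Prop. 2.5 with proof, Rem. 2.6 (authors' version pp. 5–6).
  [FantechiManetti1999T1Lifting]
* B. Fantechi, M. Manetti, *Obstruction calculus for functors of Artin rings, I*, J. Algebra 202 (1998) 541–576:
  Def. 3.5 (curvilinear obstruction), Def. 5.1 (`T¹_R`), Lemma 5.2 (`T²_R = (I/𝔪_P I)^∨`, `l_f`), Lemma 5.4 (curve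
  selection, not typed), Lemma 5.5 (arcs). [FantechiManetti1998ObstructionCalculus]
* B. Fantechi, M. Manetti, *Obstruction calculus …*: Prop. 5.3 (iii) («`(T²_R, d_e)` is the universal obstruction
  theory of `h_R`» — §6 in Def. 0.1's language). [FantechiManetti1998ObstructionCalculus]
* R. Hartshorne, *Deformation Theory*, GTM 257, Springer 2010: Theorem 11.1 (the truncations of the universal
  extension, through `T1LiftingAuxiliaryAlgebras.lean`). [Hartshorne2010]
* H. Matsumura, *Commutative Ring Theory*, CUP 1986: Thm. 13.5 ∕ 13.6 (ii) (Krull's height theorem, through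
  `ObstructionSpaceDimensionBound.lean`). [Matsumura1987]
* Z. Ran, *Hodge theory and the Hilbert scheme*, J. Differential Geom. 37 (1993) 191–198 (= [Ran2] of the quoted
  paragraph; context only). [Ran1993HodgeHilbertScheme]
-/

noncomputable section

open scoped TensorProduct

universe u

namespace Literature.AlgebraicGeometry.Deformation

variable (k : Type u) [Field k]

namespace ProRep

/-! ### §0. «A triangular `h × h` minor with nonzero elements on the diagonal»: the linear algebra -/

variable {k} in
/-- Functionals `v_1, …, v_h` on a `k`-vector space and vectors `x_1, …, x_h` with `v_i(x_j) = 0` for `j < i` and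
`v_i(x_i) ≠ 0` («the associated matrix contains a triangular `h × h` minor with nonzero elements on the diagonal»):
the `v_i` are linearly independent (evaluate a relation `∑ c_i v_i = 0` at `x_1, x_2, …` in turn).
[cite: FantechiManetti1999T1Lifting, Prop. 2.5 (proof, last sentence)] -/
theorem linearIndependent_of_apply_triangular {V : Type*} [AddCommGroup V] [Module k V] {h : ℕ}
    (v : Fin h → Module.Dual k V) (x : Fin h → V) (hlow : ∀ i j : Fin h, j < i → v i (x j) = 0)
    (hdiag : ∀ i, v i (x i) ≠ 0) : LinearIndependent k v := by
  rw [Fintype.linearIndependent_iff]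
  intro g hg
  suffices H : ∀ m : ℕ, ∀ i : Fin h, i.val = m → g i = 0 from fun i => H i.val i rfl
  intro m
  induction m using Nat.strong_induction_on with
  | _ m ih =>
    intro i hi
    have hx : (∑ j, g j • v j) (x i) = 0 := by rw [hg, LinearMap.zero_apply]
    rw [LinearMap.sum_apply, Finset.sum_eq_single i] at hx
    · rw [LinearMap.smul_apply, smul_eq_mul] at hx
      exact (mul_eq_zero.1 hx).resolve_right (hdiag i)
    · intro j _ hji
      rcases lt_or_gt_of_ne hji with hlt | hgt
      · rw [LinearMap.smul_apply, ih j.val (by rw [← hi]; exact hlt) j rfl, zero_smul]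
      · rw [LinearMap.smul_apply, hlow j i hgt, smul_zero]
    · intro hi'
      exact absurd (Finset.mem_univ i) hi'

/-! ### §1. The curvilinear obstruction induced by an arc `w : P → k[[t]]` with `w(I) ⊆ (t^p)` -/

variable {k} in
/-- A `k`-algebra map `w : k[[x_1, …, x_n]] → k[[t]]` is automatically local: it sends `𝔪_P` into `(t)`, i.e. the
constant term of `w(m)` vanishes for `m ∈ 𝔪_P` (if `w(m)(0) = c ≠ 0` then `m − c` is a unit of `P` mapped to the
non-unit `w(m) − c`). [folklore] -/
private theorem constantCoeff_arc_apply_eq_zero {n : ℕ} (w : MvPowerSeries (Fin n) k →ₐ[k] PowerSeries k)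
    {m : MvPowerSeries (Fin n) k} (hm : m ∈ IsLocalRing.maximalIdeal (MvPowerSeries (Fin n) k)) :
    PowerSeries.constantCoeff (w m) = 0 := by
  by_contra hc
  have hm0 : MvPowerSeries.constantCoeff m = 0 := by
    have h := (IsLocalRing.mem_maximalIdeal _).1 hm
    rwa [mem_nonunits_iff, MvPowerSeries.isUnit_iff_constantCoeff, isUnit_iff_ne_zero, not_not] at h
  set c : k := PowerSeries.constantCoeff (w m) with hcdef
  have hu : IsUnit (m - algebraMap k (MvPowerSeries (Fin n) k) c) := by
    rw [MvPowerSeries.isUnit_iff_constantCoeff, map_sub, hm0, ← MvPowerSeries.c_eq_algebraMap,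
      MvPowerSeries.constantCoeff_C, zero_sub, isUnit_iff_ne_zero, neg_ne_zero]
    exact hc
  have hu' := PowerSeries.isUnit_constantCoeff _ (hu.map w)
  rw [map_sub, AlgHom.commutes, map_sub, ← hcdef] at hu'
  have h0 : PowerSeries.constantCoeff (algebraMap k (PowerSeries k) c) = c := by
    rw [PowerSeries.algebraMap_eq]
    exact PowerSeries.constantCoeff_C c
  rw [h0, sub_self] at hu'
  exact not_isUnit_zero hu'

variable {k} in
/-- For `m ∈ 𝔪_P` and `x` with `w(x) ∈ (t^p)`, the `t^p`-coefficient of `w(mx) = w(m)w(x)` vanishes.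
[cite: FantechiManetti1998ObstructionCalculus, Lemma 5.2 (proof)] -/
theorem coeff_arc_apply_mul_eq_zero {n : ℕ} (w : MvPowerSeries (Fin n) k →ₐ[k] PowerSeries k) {p : ℕ}
    {m x : MvPowerSeries (Fin n) k} (hm : m ∈ IsLocalRing.maximalIdeal (MvPowerSeries (Fin n) k))
    (hx : ∀ d < p, PowerSeries.coeff d (w x) = 0) : PowerSeries.coeff p (w (m * x)) = 0 := by
  rw [map_mul, PowerSeries.coeff_mul]
  refine Finset.sum_eq_zero fun ij hij => ?_
  rw [Finset.HasAntidiagonal.mem_antidiagonal] at hij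
  by_cases hj : ij.2 < p
  · rw [hx ij.2 hj, mul_zero]
  · have hi0 : ij.1 = 0 := by omega
    rw [hi0, PowerSeries.coeff_zero_eq_constantCoeff_apply, constantCoeff_arc_apply_eq_zero w hm, zero_mul]

/-- **The obstruction induced by an arc** ([FantechiManetti1999T1Lifting, proof of Prop. 2.5]: «let
`v_i ∈ T^{2c}_R` be the obstruction induced by `φ_i`»; [FantechiManetti1998ObstructionCalculus, Lemma 5.5]): for
`P = k[[x_1, …, x_n]]`, `I ⊆ 𝔪²_P`, `R = P/I`, a `k`-algebra map `w : P → k[[t]]` with `w(I) ⊆ (t^p)`, `p ≥ 1`, the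
functional `[g] ↦ (t^p-coefficient of w(g))` on `(T²_R)^∨ = I/𝔪_P I` is well defined and is a CURVILINEAR OBSTRUCTION
of `(T²_R, l_•)` (the tree's model `ArtinFunctor.powerSeriesPointsObstructionSpace`, Def. 3.5
`curvilinearObstructions`), by Lemma 5.5 (`ProRep.mem_curvilinearObstructions_iff_exists_powerSeries_arc`, scalar
`c = 1`). [cite: FantechiManetti1998ObstructionCalculus, Lemma 5.5] [cite: FantechiManetti1999T1Lifting, Prop. 2.5 (proof)] -/
theorem exists_curvilinearObstruction_of_arc {n : ℕ} (I : Ideal (MvPowerSeries (Fin n) k))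
    (hI : I ≤ (IsLocalRing.maximalIdeal (MvPowerSeries (Fin n) k)) ^ 2)
    (w : MvPowerSeries (Fin n) k →ₐ[k] PowerSeries k) {p : ℕ} (hp : 1 ≤ p)
    (hlow : ∀ g ∈ I, ∀ d < p, PowerSeries.coeff d (w g) = 0) :
    ∃ v ∈ (ArtinFunctor.powerSeriesPointsObstructionSpace k
        (fun _ _ p hp => points_mvPowerSeries_map_surjective k p hp) I hI).curvilinearObstructions,
      ∀ (g : MvPowerSeries (Fin n) k) (hg : g ∈ I),
        v (cls k (IsLocalRing.maximalIdeal (MvPowerSeries (Fin n) k)) I g hg) = PowerSeries.coeff p (w g) := by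
  let 𝔪 := IsLocalRing.maximalIdeal (MvPowerSeries (Fin n) k)
  -- the functional `g ↦ (t^p-coefficient of w(g))` on `I`, `k`-linear
  let L : ↥(I.restrictScalars k) →ₗ[k] k :=
    (PowerSeries.coeff p : PowerSeries k →ₗ[k] k) ∘ₗ (w.toLinearMap ∘ₗ (I.restrictScalars k).subtype)
  have hL : ∀ y : ↥(I.restrictScalars k), L y = PowerSeries.coeff p (w y.1) := fun y => rfl
  -- it kills `𝔪I`
  have hker : mI k 𝔪 I ≤ LinearMap.ker L := by
    rintro ⟨y, hy⟩ hmy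
    have hmy' : y ∈ 𝔪 * I := (Submodule.restrictScalars_mem k _ y).1 hmy
    rw [LinearMap.mem_ker, hL]
    change PowerSeries.coeff p (w y) = 0
    refine Submodule.mul_induction_on hmy' (fun m hm x hx => ?_) (fun a b ha hb => ?_)
    · exact coeff_arc_apply_mul_eq_zero w hm (hlow x hx)
    · rw [map_add, map_add, ha, hb, add_zero]
  let v : Module.Dual k (IModMI k 𝔪 I) := (mI k 𝔪 I).liftQ L hker
  have hv : ∀ (g : MvPowerSeries (Fin n) k) (hg : g ∈ I), v (cls k 𝔪 I g hg) = PowerSeries.coeff p (w g) := by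
    intro g hg
    change (mI k 𝔪 I).liftQ L hker (Submodule.Quotient.mk _) = _
    rw [Submodule.liftQ_apply, hL]
  refine ⟨v, ?_, hv⟩
  rw [mem_curvilinearObstructions_iff_exists_powerSeries_arc]
  exact ⟨p, hp, w, 1, hlow, fun g hg => by rw [hv, one_mul]⟩

/-! ### §2. «Hence it is enough to prove `h ≤ dim T^{2c}_R`»: the printed step -/

/-- **[FantechiManetti1999T1Lifting, PROPOSITION 2.5, THE LAST STEP OF THE PROOF AS PRINTED** (authors' version p. 6:
«… it is enough to prove `h ≤ dim T^{2c}_R`. For `i = 1, …, h`, let `v_i ∈ T^{2c}_R` be the obstruction induced by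
`φ_i`. Then, since `f_1, …, f_d` are linearly independent in `I/𝔪I`, the elements `v_1, …, v_h` are also linearly
independent in `(I/𝔪I)^∨`, as the associated matrix contains a triangular `h × h` minor with nonzero elements on the
diagonal. □»): for `P = k[[x_1, …, x_n]]`, `I ⊆ 𝔪²_P`, `R = P/I`, elements `f_1, …, f_h ∈ I` and arcs
`φ_1, …, φ_h : P → k[[t]]` (`k`-algebra maps) with `φ_i(I) ⊆ (t^{p_i})`, `φ_i(f_j) = 0` for `j < i` and
`(t^{p_i}-coefficient of φ_i(f_i)) ≠ 0` (print's condition 2): `φ_i(f_i) ≠ 0` of order `p_i = deg φ_i(f_i)`,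
`φ_i(f_j) = 0` for `j < i`, `deg φ_i(f_j) ≥ deg φ_i(f_i)` for `j > i` — see
`le_finrank_span_curvilinearObstructions_of_printedArcs` for that wording), the induced curvilinear obstructions
`v_i : [g] ↦ (t^{p_i}-coefficient of φ_i(g))` are linearly independent, so `h ≤ dim_k T^{2c}_R`, `T^{2c}_R` = the span
of the curvilinear obstructions of `(T²_R, l_•)` (any field `k`; the algebraic closedness of Prop. 2.5 enters only
through Lemma 2.4, which PRODUCES such arcs and is not typed here).
[cite: FantechiManetti1999T1Lifting, Prop. 2.5 (proof)] -/
theorem le_finrank_span_curvilinearObstructions_of_arcs {n : ℕ} (I : Ideal (MvPowerSeries (Fin n) k))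
    (hI : I ≤ (IsLocalRing.maximalIdeal (MvPowerSeries (Fin n) k)) ^ 2) {h : ℕ}
    (f : Fin h → MvPowerSeries (Fin n) k) (hfI : ∀ i, f i ∈ I)
    (φ : Fin h → (MvPowerSeries (Fin n) k →ₐ[k] PowerSeries k)) (p : Fin h → ℕ)
    (hφI : ∀ i, ∀ g ∈ I, ∀ d < p i, PowerSeries.coeff d (φ i g) = 0)
    (hφlow : ∀ i j : Fin h, j < i → φ i (f j) = 0)
    (hφdiag : ∀ i, PowerSeries.coeff (p i) (φ i (f i)) ≠ 0) :
    (h : ℕ) ≤ Module.finrank k (Submodule.span k (ArtinFunctor.powerSeriesPointsObstructionSpace k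
        (fun _ _ p hp => points_mvPowerSeries_map_surjective k p hp) I hI).curvilinearObstructions) := by
  let 𝔪 := IsLocalRing.maximalIdeal (MvPowerSeries (Fin n) k)
  -- `p_i ≥ 1`: `f_i ∈ I ⊆ 𝔪`, so `φ_i(f_i)` has no constant term
  have hp : ∀ i, 1 ≤ p i := fun i => by
    by_contra h0
    have hp0 : p i = 0 := by omega
    apply hφdiag i
    rw [hp0, PowerSeries.coeff_zero_eq_constantCoeff_apply]
    exact constantCoeff_arc_apply_eq_zero (φ i) (Ideal.pow_le_self two_ne_zero (hI (hfI i)))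
  -- the obstructions `v_i` induced by the `φ_i`
  choose v hvT hv using fun i => exists_curvilinearObstruction_of_arc k I hI (φ i) (hp i) (hφI i)
  -- triangular evaluations on the classes `[f_j]`
  have hli : LinearIndependent k v := by
    refine linearIndependent_of_apply_triangular v (fun j => cls k 𝔪 I (f j) (hfI j)) (fun i j hji => ?_)
      (fun i => ?_)
    · rw [hv i, hφlow i j hji, map_zero]
    · rw [hv i]; exact hφdiag i
  -- the `v_i` lie in `T^{2c}_R`, a subspace of the finite-dimensional `(I/𝔪I)^∨`
  haveI := finite_IModMI_mvPowerSeries k I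
  set W := Submodule.span k (ArtinFunctor.powerSeriesPointsObstructionSpace k
        (fun _ _ p hp => points_mvPowerSeries_map_surjective k p hp) I hI).curvilinearObstructions with hW
  let u : Fin h → W := fun i => ⟨v i, Submodule.subset_span (hvT i)⟩
  have hu : LinearIndependent k u := LinearIndependent.of_comp W.subtype (by exact hli)
  simpa only [Fintype.card_fin] using hu.fintype_card_le_finrank

/-- **Condition 2) VERBATIM** («2) for all `i ≤ h` there exists a morphism `φ_i : P → k[[t]]` in `Ârt_k` such that
`φ_i(f_i) ≠ 0`, `φ_i(f_j) = 0` if `j < i` and `deg φ_i(f_j) ≥ deg φ_i(f_i)` if `j > i`», `deg` = the order of a power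
series, `I = (f_1, …, f_d)`, `h ≤ d`): it yields the coefficient form of `le_finrank_span_curvilinearObstructions_of_arcs`
with `p_i := deg φ_i(f_i)` — `φ_i(f_j) ∈ (t^{p_i})` for EVERY `j ≤ d`, hence `φ_i(I) ⊆ (t^{p_i})`, and the
`t^{p_i}`-coefficient of `φ_i(f_i)` is its (nonzero) leading coefficient — so `h ≤ dim_k T^{2c}_R`. (Condition 1)
`f_i ∉ √(f_1, …, f_{i−1})` is what Lemma 2.4 uses to construct the `φ_i`; it plays no role afterwards and is not a
hypothesis here.) [cite: FantechiManetti1999T1Lifting, Prop. 2.5 (proof)] -/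
theorem le_finrank_span_curvilinearObstructions_of_printedArcs {n : ℕ} (I : Ideal (MvPowerSeries (Fin n) k))
    (hI : I ≤ (IsLocalRing.maximalIdeal (MvPowerSeries (Fin n) k)) ^ 2) {d h : ℕ} (hhd : h ≤ d)
    (f : Fin d → MvPowerSeries (Fin n) k) (hIf : I = Ideal.span (Set.range f))
    (φ : Fin h → (MvPowerSeries (Fin n) k →ₐ[k] PowerSeries k))
    (h2a : ∀ i : Fin h, φ i (f (Fin.castLE hhd i)) ≠ 0)
    (h2b : ∀ (i : Fin h) (j : Fin d), j.val < i.val → φ i (f j) = 0)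
    (h2c : ∀ (i : Fin h) (j : Fin d), i.val < j.val → (φ i (f (Fin.castLE hhd i))).order ≤ (φ i (f j)).order) :
    (h : ℕ) ≤ Module.finrank k (Submodule.span k (ArtinFunctor.powerSeriesPointsObstructionSpace k
        (fun _ _ p hp => points_mvPowerSeries_map_surjective k p hp) I hI).curvilinearObstructions) := by
  -- `p_i := deg φ_i(f_i)`
  let p : Fin h → ℕ := fun i => (φ i (f (Fin.castLE hhd i))).order.toNat
  have hfI : ∀ j : Fin d, f j ∈ I := fun j => by rw [hIf]; exact Ideal.subset_span ⟨j, rfl⟩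
  -- `φ_i(f_j) ∈ (t^{p_i})` for every `j`
  have hdvd : ∀ (i : Fin h) (j : Fin d), (PowerSeries.X : PowerSeries k) ^ p i ∣ φ i (f j) := by
    intro i j
    rcases lt_trichotomy j.val i.val with hlt | heq | hgt
    · rw [h2b i j hlt]; exact dvd_zero _
    · have hj : j = Fin.castLE hhd i := Fin.ext heq
      subst hj
      exact PowerSeries.X_pow_dvd_iff.2 fun m hm => PowerSeries.coeff_of_lt_order_toNat m hm
    · refine PowerSeries.X_pow_dvd_iff.2 fun m hm => PowerSeries.coeff_of_lt_order m ?_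
      refine lt_of_lt_of_le ?_ (h2c i j hgt)
      have hne : (φ i (f (Fin.castLE hhd i))).order ≠ ⊤ := by
        rw [Ne, PowerSeries.order_eq_top]; exact h2a i
      rw [← ENat.coe_toNat hne]
      exact_mod_cast hm
  -- hence `φ_i(I) ⊆ (t^{p_i})`
  have hφI : ∀ i, ∀ g ∈ I, ∀ m < p i, PowerSeries.coeff m (φ i g) = 0 := by
    intro i g hg
    have hg' : (PowerSeries.X : PowerSeries k) ^ p i ∣ φ i g := by
      rw [← Ideal.mem_span_singleton, ← Ideal.mem_comap]
      rw [hIf] at hg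
      refine (Ideal.span_le.2 ?_) hg
      rintro _ ⟨j, rfl⟩
      rw [SetLike.mem_coe, Ideal.mem_comap, Ideal.mem_span_singleton]
      exact hdvd i j
    exact PowerSeries.X_pow_dvd_iff.1 hg'
  refine le_finrank_span_curvilinearObstructions_of_arcs k I hI (fun i => f (Fin.castLE hhd i))
    (fun i => hfI _) φ p hφI (fun i j hji => h2b i _ ?_) (fun i => PowerSeries.coeff_order (h2a i))
  rw [Fin.val_castLE]
  exact Fin.lt_def.1 hji

/-! ### §3. «Condition 3) implies that `dim R = dim P/(f_1, …, f_h)`» -/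

/-- Ideals between `J` and `√J` have the same zero locus, hence quotients of the same Krull dimension:
`J ⊆ I ⊆ √J ⇒ dim R/I = dim R/J` (`Spec R/I ≅ V(I) = V(J) ≅ Spec R/J` as ordered sets).
[cite: FantechiManetti1999T1Lifting, Prop. 2.5 (proof)] -/
theorem ringKrullDim_quotient_eq_of_le_of_le_radical {R : Type*} [CommRing R] {I J : Ideal R} (hJI : J ≤ I)
    (hIJ : I ≤ J.radical) : ringKrullDim (R ⧸ I) = ringKrullDim (R ⧸ J) := by
  have hZ : PrimeSpectrum.zeroLocus (I : Set R) = PrimeSpectrum.zeroLocus (J : Set R) := by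
    apply le_antisymm
    · exact PrimeSpectrum.zeroLocus_anti_mono_ideal hJI
    · rw [← PrimeSpectrum.zeroLocus_radical J]
      exact PrimeSpectrum.zeroLocus_anti_mono_ideal hIJ
  unfold ringKrullDim
  rw [Order.krullDim_eq_of_orderIso (Ideal.primeSpectrumQuotientOrderIsoZeroLocus I),
    Order.krullDim_eq_of_orderIso (Ideal.primeSpectrumQuotientOrderIsoZeroLocus J)]
  exact Order.krullDim_eq_of_orderIso (OrderIso.setCongr _ _ hZ)

/-- «Condition 3) implies that `dim R = dim P/(f_1, …, f_h)`»: for `f_1, …, f_h ∈ I` with `I ⊆ √(f_1, …, f_h)`,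
`dim P/I = dim P/(f_1, …, f_h)`. [cite: FantechiManetti1999T1Lifting, Prop. 2.5 (proof)] -/
theorem ringKrullDim_quotient_eq_of_le_radical_span {P : Type*} [CommRing P] (I : Ideal P) {h : ℕ}
    (f : Fin h → P) (hfI : ∀ i, f i ∈ I) (hIrad : I ≤ (Ideal.span (Set.range f)).radical) :
    ringKrullDim (P ⧸ I) = ringKrullDim (P ⧸ Ideal.span (Set.range f)) :=
  ringKrullDim_quotient_eq_of_le_of_le_radical
    (Ideal.span_le.2 (by rintro _ ⟨i, rfl⟩; exact hfI i)) hIrad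

/-! ### §4. Proposition 2.5 assembled, modulo Lemma 2.4 (the arcs are data) -/

/-- **[FantechiManetti1999T1Lifting, PROPOSITION 2.5] — THE PROOF AS PRINTED, MODULO LEMMA 2.4** (p. 6: «Let `R ∈ Ârt_k`,
and assume `k = k̄`. Let `T^{2c}_R` be the vector subspace of `T²_R` generated by curvilinear obstructions. Then
`dim R ≥ dim T¹_R − dim T^{2c}_R`. Proof. Write `R = P/I`, with `P` a power series algebra and `I ⊂ 𝔪²_P`. … we can
assume that there exists an `h ≤ d` such that the following holds: 1) …; 2) for all `i ≤ h` there exists a morphism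
`φ_i : P → k[[t]]` in `Ârt_k` such that `φ_i(f_i) ≠ 0`, `φ_i(f_j) = 0` if `j < i` and `deg φ_i(f_j) ≥ deg φ_i(f_i)` if
`j > i`; 3) `I ⊂ √(f_1, …, f_h)`. Condition 3) implies that `dim R = dim P/(f_1, …, f_h)`, hence it is enough to prove
`h ≤ dim T^{2c}_R`. …»): for `P = k[[x_1, …, x_n]]` (so `n = dim T¹_R`, `I ⊆ 𝔪²`), GIVEN `f_1, …, f_h ∈ I` with 3)
`I ⊆ √(f_1, …, f_h)` and arcs `φ_i` as in 2) (in the coefficient form of `le_finrank_span_curvilinearObstructions_of_arcs`),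
`n ≤ dim (P/I) + dim_k T^{2c}_R`, i.e. «`dim R ≥ dim T¹_R − dim T^{2c}_R`» — Krull's height theorem
`dim P/(f_1, …, f_h) ≥ n − h` (`ProRep.powerSeries_le_ringKrullDim_quotient_add_card`, [Matsumura1987, Thm. 13.6 (ii)])
+ §3 + §2. Any field `k`: the hypothesis `k = k̄` of Prop. 2.5 is what Lemma 2.4 (curve selection) needs to PRODUCE the
data 1)–3); that lemma is not typed (cf. [FantechiManetti1998ObstructionCalculus, Lemma 5.4]) and over `k = ℝ` the
conclusion fails ([FantechiManetti1999T1Lifting, Ex. 2.3], the tree's `FM99Example23.*`).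
[cite: FantechiManetti1999T1Lifting, Prop. 2.5] -/
theorem powerSeries_le_ringKrullDim_add_finrank_span_curvilinearObstructions_of_arcs {n : ℕ}
    (I : Ideal (MvPowerSeries (Fin n) k)) (hI : I ≤ (IsLocalRing.maximalIdeal (MvPowerSeries (Fin n) k)) ^ 2)
    {h : ℕ} (f : Fin h → MvPowerSeries (Fin n) k) (hfI : ∀ i, f i ∈ I)
    (hIrad : I ≤ (Ideal.span (Set.range f)).radical)
    (φ : Fin h → (MvPowerSeries (Fin n) k →ₐ[k] PowerSeries k)) (p : Fin h → ℕ)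
    (hφI : ∀ i, ∀ g ∈ I, ∀ d < p i, PowerSeries.coeff d (φ i g) = 0)
    (hφlow : ∀ i j : Fin h, j < i → φ i (f j) = 0)
    (hφdiag : ∀ i, PowerSeries.coeff (p i) (φ i (f i)) ≠ 0) :
    (n : WithBot ℕ∞) ≤ ringKrullDim (MvPowerSeries (Fin n) k ⧸ I) +
      Module.finrank k (Submodule.span k (ArtinFunctor.powerSeriesPointsObstructionSpace k
        (fun _ _ p hp => points_mvPowerSeries_map_surjective k p hp) I hI).curvilinearObstructions) := by
  classical
  -- «Condition 3) implies that dim R = dim P/(f_1, …, f_h)»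
  rw [ringKrullDim_quotient_eq_of_le_radical_span I f hfI hIrad]
  -- Krull: `n ≤ dim P/(f_1, …, f_h) + h`
  let s : Finset (MvPowerSeries (Fin n) k) := Finset.univ.image f
  have hs : (s : Set (MvPowerSeries (Fin n) k)) = Set.range f := by
    simp only [s, Finset.coe_image, Finset.coe_univ, Set.image_univ]
  have hs𝔪 : (s : Set (MvPowerSeries (Fin n) k)) ⊆ IsLocalRing.maximalIdeal (MvPowerSeries (Fin n) k) := by
    rw [hs]
    rintro _ ⟨i, rfl⟩
    exact Ideal.pow_le_self two_ne_zero (hI (hfI i))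
  have hK := powerSeries_le_ringKrullDim_quotient_add_card s hs𝔪
  rw [hs] at hK
  have hcard : s.card ≤ h := by
    simpa only [Finset.card_univ, Fintype.card_fin] using (Finset.card_image_le (s := Finset.univ) (f := f))
  -- «it is enough to prove h ≤ dim T^{2c}_R»
  have hh := le_finrank_span_curvilinearObstructions_of_arcs k I hI f hfI φ p hφI hφlow hφdiag
  refine hK.trans ?_
  gcongr
  exact_mod_cast hcard.trans hh

/-- The same in natural numbers: `dim R = e` for some `e ∈ ℕ` with `n ≤ e + dim_k T^{2c}_R`.
[cite: FantechiManetti1999T1Lifting, Prop. 2.5] -/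
theorem powerSeries_exists_ringKrullDim_eq_le_add_finrank_span_curvilinearObstructions_of_arcs {n : ℕ}
    (I : Ideal (MvPowerSeries (Fin n) k)) (hI : I ≤ (IsLocalRing.maximalIdeal (MvPowerSeries (Fin n) k)) ^ 2)
    {h : ℕ} (f : Fin h → MvPowerSeries (Fin n) k) (hfI : ∀ i, f i ∈ I)
    (hIrad : I ≤ (Ideal.span (Set.range f)).radical)
    (φ : Fin h → (MvPowerSeries (Fin n) k →ₐ[k] PowerSeries k)) (p : Fin h → ℕ)
    (hφI : ∀ i, ∀ g ∈ I, ∀ d < p i, PowerSeries.coeff d (φ i g) = 0)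
    (hφlow : ∀ i j : Fin h, j < i → φ i (f j) = 0)
    (hφdiag : ∀ i, PowerSeries.coeff (p i) (φ i (f i)) ≠ 0) :
    ∃ e : ℕ, ringKrullDim (MvPowerSeries (Fin n) k ⧸ I) = e ∧
      n ≤ e + Module.finrank k (Submodule.span k (ArtinFunctor.powerSeriesPointsObstructionSpace k
        (fun _ _ p hp => points_mvPowerSeries_map_surjective k p hp) I hI).curvilinearObstructions) := by
  have hI1 : I ≠ ⊤ :=
    ne_top_of_le_ne_top (Ideal.IsMaximal.ne_top (IsLocalRing.maximalIdeal.isMaximal _))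
      (hI.trans (Ideal.pow_le_self two_ne_zero))
  obtain ⟨e, he⟩ := powerSeries_exists_ringKrullDim_quotient_eq I hI1
  refine ⟨e, he, ?_⟩
  have hmain := powerSeries_le_ringKrullDim_add_finrank_span_curvilinearObstructions_of_arcs k I hI f hfI hIrad φ p
    hφI hφlow hφdiag
  rw [he] at hmain
  exact_mod_cast hmain

/-- **«`dim R ≥ dim T¹_R − dim T^{2c}_R`» with `dim T¹_R` the embedding dimension** ([FantechiManetti1998ObstructionCalculus,
Def. 5.1]: `T¹_R = (𝔪_R/𝔪_R²)^∨`, «the embedding dimension of `R`»; for `R = P/I`, `I ⊆ 𝔪²_P`, `emb dim R = n`,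
the tree's `ProRep.powerSeries_spanFinrank_maximalIdeal_quotient_eq`): under the data of Prop. 2.5's proof,
`emb dim R ≤ dim R + dim_k T^{2c}_R`. [cite: FantechiManetti1999T1Lifting, Prop. 2.5] -/
theorem powerSeries_spanFinrank_maximalIdeal_le_ringKrullDim_add_finrank_span_curvilinearObstructions_of_arcs {n : ℕ}
    (I : Ideal (MvPowerSeries (Fin n) k)) (hI : I ≤ (IsLocalRing.maximalIdeal (MvPowerSeries (Fin n) k)) ^ 2)
    [IsLocalRing (MvPowerSeries (Fin n) k ⧸ I)]
    {h : ℕ} (f : Fin h → MvPowerSeries (Fin n) k) (hfI : ∀ i, f i ∈ I)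
    (hIrad : I ≤ (Ideal.span (Set.range f)).radical)
    (φ : Fin h → (MvPowerSeries (Fin n) k →ₐ[k] PowerSeries k)) (p : Fin h → ℕ)
    (hφI : ∀ i, ∀ g ∈ I, ∀ d < p i, PowerSeries.coeff d (φ i g) = 0)
    (hφlow : ∀ i j : Fin h, j < i → φ i (f j) = 0)
    (hφdiag : ∀ i, PowerSeries.coeff (p i) (φ i (f i)) ≠ 0) :
    ((IsLocalRing.maximalIdeal (MvPowerSeries (Fin n) k ⧸ I)).spanFinrank : WithBot ℕ∞) ≤
      ringKrullDim (MvPowerSeries (Fin n) k ⧸ I) +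
        Module.finrank k (Submodule.span k (ArtinFunctor.powerSeriesPointsObstructionSpace k
          (fun _ _ p hp => points_mvPowerSeries_map_surjective k p hp) I hI).curvilinearObstructions) := by
  rw [powerSeries_spanFinrank_maximalIdeal_quotient_eq (k := k) I hI]
  exact powerSeries_le_ringKrullDim_add_finrank_span_curvilinearObstructions_of_arcs k I hI f hfI hIrad φ p hφI hφlow
    hφdiag

/-! ### §5. «The theorem follows from proposition 2.5»: Theorem 2.2's deduction, with 0.3's embedding as a hypothesis -/

open T1Lifting

variable {k} in
/-- `θ((T ⊗ f)(x)) = (W ⊗ f)((θ ⊗ M)(x))` read through `T ⊗ k = T`, `W ⊗ k = W`. [folklore] -/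
private theorem apply_rid_lTensor_eq_rid_lTensor_rTensor {T W M : Type u} [AddCommGroup T] [Module k T]
    [AddCommGroup W] [Module k W] [AddCommGroup M] [Module k M] (θ : T →ₗ[k] W) (f : Module.Dual k M)
    (x : T ⊗[k] M) :
    θ (TensorProduct.rid k T (f.lTensor T x)) = TensorProduct.rid k W (f.lTensor W (θ.rTensor M x)) := by
  induction x using TensorProduct.induction_on with
  | zero => simp only [map_zero]
  | tmul t m => simp only [LinearMap.lTensor_tmul, LinearMap.rTensor_tmul, TensorProduct.rid_tmul, map_smul]
  | add x y hx hy => simp only [map_add, hx, hy]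

variable {k} in
/-- **«`T^{2c}_F = T^{2c}_R`», the inclusion `⊇` from compatibility** ([FantechiManetti1999T1Lifting, proof of Thm. 2.2]:
«Then `T²_F` is naturally an obstruction space for `h_R`, hence by 0.3 it contains `T²_R` as a vector subspace and
`T^{2c}_F = T^{2c}_R`»): for functors of Artin rings `F`, `G` with obstruction spaces `(T, ob^F)`, `(W, ob^G)` (Def. 0.1),
maps `ν_A : F(A) → G(A)` and a `k`-linear `θ : T → W` COMPATIBLE with the obstruction maps of the curvilinear extensions
`e_N : A_{N+1} → A_N` (`ob^G_{e_N}(ν a) = (θ ⊗ K(e_N))(ob^F_{e_N}(a))`), `θ` carries curvilinear obstructions of `F` to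
curvilinear obstructions of `G` (same `e_N`, element `ν a`, functional `f`). Naturality of `ν` is not used.
[cite: FantechiManetti1999T1Lifting, Thm. 2.2 (proof)] -/
theorem image_curvilinearObstructions_subset_of_compatible {F G : ArtinFunctor.{u} k} {T W : Type u}
    [AddCommGroup T] [Module k T] [AddCommGroup W] [Module k W] (OF : F.ObstructionSpace T)
    (OG : G.ObstructionSpace W) (ν : ∀ R : ArtAlg.{u} k, F.obj R → G.obj R) (θ : T →ₗ[k] W)
    (hθ : ∀ (N : ℕ) (a : F.obj (artA k N)),
      OG.ob (R₁ := artA k (N + 1)) (R₀ := artA k N) (i k N) (isSmallExtension_i k N).isSmallExt (ν _ a) =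
        θ.rTensor _ (OF.ob (R₁ := artA k (N + 1)) (R₀ := artA k N) (i k N) (isSmallExtension_i k N).isSmallExt a)) :
    θ '' OF.curvilinearObstructions ⊆ OG.curvilinearObstructions := by
  rintro _ ⟨v, ⟨N, a, f, rfl⟩, rfl⟩
  exact ⟨N, ν _ a, f, by rw [hθ, apply_rid_lTensor_eq_rid_lTensor_rTensor]⟩

variable {k} in
/-- **«`T^{2c}_F = T^{2c}_R`», the inclusion `⊆`**: if moreover each `ν_{A_N}` is SURJECTIVE (as for a hull — a smooth
morphism from `h_R` is surjective on objects), every curvilinear obstruction of `G` is the image under `θ` of a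
curvilinear obstruction of `F`. [cite: FantechiManetti1999T1Lifting, Thm. 2.2 (proof)] -/
theorem curvilinearObstructions_subset_image_of_compatible {F G : ArtinFunctor.{u} k} {T W : Type u}
    [AddCommGroup T] [Module k T] [AddCommGroup W] [Module k W] (OF : F.ObstructionSpace T)
    (OG : G.ObstructionSpace W) (ν : ∀ R : ArtAlg.{u} k, F.obj R → G.obj R) (θ : T →ₗ[k] W)
    (hθ : ∀ (N : ℕ) (a : F.obj (artA k N)),
      OG.ob (R₁ := artA k (N + 1)) (R₀ := artA k N) (i k N) (isSmallExtension_i k N).isSmallExt (ν _ a) =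
        θ.rTensor _ (OF.ob (R₁ := artA k (N + 1)) (R₀ := artA k N) (i k N) (isSmallExtension_i k N).isSmallExt a))
    (hsurj : ∀ N : ℕ, Function.Surjective (ν (artA k N))) :
    OG.curvilinearObstructions ⊆ θ '' OF.curvilinearObstructions := by
  rintro _ ⟨N, y, f, rfl⟩
  obtain ⟨a, rfl⟩ := hsurj N y
  exact ⟨_, ⟨N, a, f, rfl⟩, by rw [hθ, apply_rid_lTensor_eq_rid_lTensor_rTensor]⟩

variable {k} in
/-- **«`T^{2c}_F = T^{2c}_R`» as an EQUALITY of the sets of curvilinear obstructions under `θ`**, for `θ` compatible on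
the `e_N` and `ν` surjective on the `A_N`. [cite: FantechiManetti1999T1Lifting, Thm. 2.2 (proof)] -/
theorem image_curvilinearObstructions_eq_of_compatible {F G : ArtinFunctor.{u} k} {T W : Type u}
    [AddCommGroup T] [Module k T] [AddCommGroup W] [Module k W] (OF : F.ObstructionSpace T)
    (OG : G.ObstructionSpace W) (ν : ∀ R : ArtAlg.{u} k, F.obj R → G.obj R) (θ : T →ₗ[k] W)
    (hθ : ∀ (N : ℕ) (a : F.obj (artA k N)),
      OG.ob (R₁ := artA k (N + 1)) (R₀ := artA k N) (i k N) (isSmallExtension_i k N).isSmallExt (ν _ a) =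
        θ.rTensor _ (OF.ob (R₁ := artA k (N + 1)) (R₀ := artA k N) (i k N) (isSmallExtension_i k N).isSmallExt a))
    (hsurj : ∀ N : ℕ, Function.Surjective (ν (artA k N))) :
    θ '' OF.curvilinearObstructions = OG.curvilinearObstructions :=
  (image_curvilinearObstructions_subset_of_compatible OF OG ν θ hθ).antisymm
    (curvilinearObstructions_subset_image_of_compatible OF OG ν θ hθ hsurj)

variable {k} in
/-- Hence, for `θ` INJECTIVE («contains `T²_R` as a vector subspace») and `W` finite-dimensional,
`dim_k T^{2c}_F ≥ dim_k T^{2c}` of the source. [cite: FantechiManetti1999T1Lifting, Thm. 2.2 (proof)] -/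
theorem finrank_span_curvilinearObstructions_le_of_compatible {F G : ArtinFunctor.{u} k} {T W : Type u}
    [AddCommGroup T] [Module k T] [AddCommGroup W] [Module k W] [Module.Finite k W] (OF : F.ObstructionSpace T)
    (OG : G.ObstructionSpace W) (ν : ∀ R : ArtAlg.{u} k, F.obj R → G.obj R) (θ : T →ₗ[k] W)
    (hinj : Function.Injective θ)
    (hθ : ∀ (N : ℕ) (a : F.obj (artA k N)),
      OG.ob (R₁ := artA k (N + 1)) (R₀ := artA k N) (i k N) (isSmallExtension_i k N).isSmallExt (ν _ a) =
        θ.rTensor _ (OF.ob (R₁ := artA k (N + 1)) (R₀ := artA k N) (i k N) (isSmallExtension_i k N).isSmallExt a)) :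
    Module.finrank k (Submodule.span k OF.curvilinearObstructions) ≤
      Module.finrank k (Submodule.span k OG.curvilinearObstructions) := by
  have hmap : (Submodule.span k OF.curvilinearObstructions).map θ ≤ Submodule.span k OG.curvilinearObstructions := by
    rw [Submodule.map_span]
    exact Submodule.span_mono (image_curvilinearObstructions_subset_of_compatible OF OG ν θ hθ)
  calc Module.finrank k (Submodule.span k OF.curvilinearObstructions)
      = Module.finrank k ((Submodule.span k OF.curvilinearObstructions).map θ) :=
        LinearEquiv.finrank_eq (Submodule.equivMapOfInjective θ hinj _)
    _ ≤ Module.finrank k (Submodule.span k OG.curvilinearObstructions) := Submodule.finrank_mono hmap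

/-- **[FantechiManetti1999T1Lifting, THEOREM 2.2], THE PRINTED DEDUCTION FROM PROPOSITION 2.5 — MODULO LEMMA 2.4 AND
MODULO LEMMA 0.3's COMPATIBLE EMBEDDING** (p. 5: «THEOREM 2.2. Let `F` be a deformation functor, and let `T^{2c}_F` be
the vector subspace of `T²_F` generated by curvilinear obstructions. If `k` is algebraically closed, then the dimension
of the hull of `F` is `≥ dim T¹_F − dim T^{2c}_F`.» p. 6: «Proof of theorem 2.2. Let `h_R → F` be a smooth morphism
(that is, `R` is a hull for `F`). Then `T²_F` is naturally an obstruction space for `h_R`, hence by 0.3 it contains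
`T²_R` as a vector subspace and `T^{2c}_F = T^{2c}_R`. The theorem follows from proposition 2.5. □»): for `R = P/I`,
`P = k[[x_1, …, x_n]]`, `I ⊆ 𝔪²`, a functor of Artin rings `F` with an obstruction space `(W, ob^F)` of finite dimension,
maps `ν_A : h_R(A) → F(A)`, an INJECTIVE `k`-linear `θ : T²_R → W` compatible with the obstruction maps of the `e_N`
(the two outputs of «by 0.3 it contains `T²_R` as a vector subspace», taken as HYPOTHESES — the tree's 0.3 embedding
`ProRep.toObstructionSpaceJ` is not proved compatible with the `e_N`), and the data of Prop. 2.5's proof (arcs as in 2),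
`I ⊆ √(f_1, …, f_h)`): `n ≤ dim R + dim_k T^{2c}_F` — «the dimension of the hull `≥ dim T¹_F − dim T^{2c}_F`» with
`dim T¹_F = dim T¹_R = n` for a hull. Neither the smoothness of `ν` nor (H1)–(H3) are used in this deduction (in print
they produce `R`, `θ` and the compatibility). [cite: FantechiManetti1999T1Lifting, Thm. 2.2] -/
theorem powerSeries_le_ringKrullDim_add_finrank_span_curvilinearObstructions_of_compatible_of_arcs {n : ℕ}
    (I : Ideal (MvPowerSeries (Fin n) k)) (hI : I ≤ (IsLocalRing.maximalIdeal (MvPowerSeries (Fin n) k)) ^ 2)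
    (F : ArtinFunctor.{u} k) {W : Type u} [AddCommGroup W] [Module k W] [Module.Finite k W]
    (OF : F.ObstructionSpace W)
    (ν : ∀ R : ArtAlg.{u} k, (ArtinFunctor.points (k := k) (MvPowerSeries (Fin n) k ⧸ I)).obj R → F.obj R)
    (θ : Module.Dual k (IModMI k (IsLocalRing.maximalIdeal (MvPowerSeries (Fin n) k)) I) →ₗ[k] W)
    (hinj : Function.Injective θ)
    (hθ : ∀ (N : ℕ) (a : (ArtinFunctor.points (k := k) (MvPowerSeries (Fin n) k ⧸ I)).obj (artA k N)),
      OF.ob (R₁ := artA k (N + 1)) (R₀ := artA k N) (i k N) (isSmallExtension_i k N).isSmallExt (ν _ a) =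
        θ.rTensor _ ((ArtinFunctor.powerSeriesPointsObstructionSpace k
          (fun _ _ p hp => points_mvPowerSeries_map_surjective k p hp) I hI).ob
          (R₁ := artA k (N + 1)) (R₀ := artA k N) (i k N) (isSmallExtension_i k N).isSmallExt a))
    {h : ℕ} (f : Fin h → MvPowerSeries (Fin n) k) (hfI : ∀ i, f i ∈ I)
    (hIrad : I ≤ (Ideal.span (Set.range f)).radical)
    (φ : Fin h → (MvPowerSeries (Fin n) k →ₐ[k] PowerSeries k)) (p : Fin h → ℕ)
    (hφI : ∀ i, ∀ g ∈ I, ∀ d < p i, PowerSeries.coeff d (φ i g) = 0)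
    (hφlow : ∀ i j : Fin h, j < i → φ i (f j) = 0)
    (hφdiag : ∀ i, PowerSeries.coeff (p i) (φ i (f i)) ≠ 0) :
    (n : WithBot ℕ∞) ≤ ringKrullDim (MvPowerSeries (Fin n) k ⧸ I) +
      Module.finrank k (Submodule.span k OF.curvilinearObstructions) := by
  have h25 := powerSeries_le_ringKrullDim_add_finrank_span_curvilinearObstructions_of_arcs k I hI f hfI hIrad φ p
    hφI hφlow hφdiag
  have hc := finrank_span_curvilinearObstructions_le_of_compatible
    (ArtinFunctor.powerSeriesPointsObstructionSpace k (fun _ _ p hp => points_mvPowerSeries_map_surjective k p hp) I hI)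
    OF ν θ hinj hθ
  refine h25.trans ?_
  gcongr

/-! ### §6. «Canonically»: Lemma 0.3's embedding `T²_R → T²` is COMPATIBLE with the obstruction maps of every small
extension through which a truncation of the universal extension factors (the universality of `(T²_R, l_•)`,
[FM98, Prop. 5.3 (iii)], on those extensions) -/

section Universality

variable {k}
variable {P : Type u} [CommRing P] [Algebra k P] {𝔪 I J₁ J₂ : Ideal P} (hJ : IsTruncation 𝔪 I J₁ J₂)
variable (hsm : ∀ ⦃R₁ R₀ : ArtAlg.{u} k⦄ (p : R₁ →ₐ[k] R₀), Function.Surjective p →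
    ∀ ψ : P →ₐ[k] R₀, ∃ φ : P →ₐ[k] R₁, p.comp φ = ψ)
variable (hloc : ∀ (S : ArtAlg.{u} k) (ψ : P →ₐ[k] S), ∀ x ∈ 𝔪, ψ x ∈ IsLocalRing.maximalIdeal S)
variable (hres : ∀ x : P, ∃ c : k, x - algebraMap k P c ∈ 𝔪)
variable [IsArtinianRing (P ⧸ J₁)] [IsLocalRing (P ⧸ J₁)] (aug₁ : (P ⧸ J₁) →ₐ[k] k)
variable [IsArtinianRing (P ⧸ J₂)] [IsLocalRing (P ⧸ J₂)] (aug₂ : (P ⧸ J₂) →ₐ[k] k)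

/-- The tensor bookkeeping of «`v ↦ (T² ⊗ v)(ob_u(a))`»: if `Θ(v) = (T ⊗ (v ∘ e⁻¹))(x)` for all `v ∈ V^∨` (`x ∈ T ⊗ K'`,
`e : V ≅ K'`), then for every `y ∈ V^∨ ⊗ K`, `(Θ ⊗ K)(y) = (T ⊗ (ŷ ∘ e⁻¹))(x)` with `ŷ : V → K` the linear map of
`y`. [folklore] -/
private theorem rTensor_eq_lTensor_dualTensorHom {T V K K' : Type u} [AddCommGroup T] [Module k T]
    [AddCommGroup V] [Module k V] [AddCommGroup K] [Module k K] [AddCommGroup K'] [Module k K']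
    (e : V ≃ₗ[k] K') (x : T ⊗[k] K') (Θ : Module.Dual k V →ₗ[k] T)
    (hΘ : ∀ v, Θ v = TensorProduct.rid k T ((v ∘ₗ e.symm.toLinearMap).lTensor T x))
    (y : Module.Dual k V ⊗[k] K) :
    Θ.rTensor K y = ((dualTensorHom k V K y) ∘ₗ e.symm.toLinearMap).lTensor T x := by
  induction y using TensorProduct.induction_on with
  | zero => simp only [map_zero, LinearMap.zero_comp, LinearMap.lTensor_zero, LinearMap.zero_apply]
  | tmul v c =>
    rw [LinearMap.rTensor_tmul, hΘ]
    clear hΘ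
    induction x using TensorProduct.induction_on with
    | zero => simp only [map_zero, TensorProduct.zero_tmul]
    | tmul t m =>
      simp only [LinearMap.lTensor_tmul, LinearMap.comp_apply, LinearEquiv.coe_toLinearMap, TensorProduct.rid_tmul,
        dualTensorHom_apply, TensorProduct.smul_tmul', TensorProduct.tmul_smul]
    | add x y hx hy => simp only [map_add, TensorProduct.add_tmul, hx, hy]
  | add y z hy hz => simp only [map_add, hy, hz, LinearMap.add_comp, LinearMap.lTensor_add, LinearMap.add_apply]

/-- **«Canonically» = compatibly with the obstruction maps** ([FantechiManetti1999T1Lifting, Lemma 0.3]: «every other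
obstruction space contains `T²_R` canonically as a vector subspace»; proof of Thm. 2.2: «hence by 0.3 it contains
`T²_R` as a vector subspace and `T^{2c}_F = T^{2c}_R`»; = the universality of `(T²_R, d_e)`,
[FantechiManetti1998ObstructionCalculus, Prop. 5.3 (iii)] «`(T²_R, d_e)` is the universal obstruction theory of `h_R`»,
here for the extensions reached from a truncation): for `R = P/I`, `I ⊆ 𝔪²`, a truncation `u : P/J₁ → P/J₂` of the
universal extension ([Hartshorne2010, Thm. 11.1]), ANY obstruction space `(T², ob′)` of `h_R` (Def. 0.1) and its canonical
map `θ : T²_R = (I/𝔪I)^∨ → T²` (`ProRep.toObstructionSpaceJ`): for every small extension `p : B → A` of `Art_k`, every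
`a ∈ h_R(A)` and every lifting `φ : P → B` of `a` that KILLS `J₁` (so that it factors through `u`),
`ob′_p(a) = (θ ⊗ K(p))(ob_p(a))` with `ob_p(a) ∈ T²_R ⊗ K(p)` the obstruction of the model (`l_φ`,
`ArtinFunctor.pointsObstructionSpace`). Proof: Def. 0.1 (ii) for `ob′` along the morphism of extensions
`(φ̄ : P/J₁ → B, ā : P/J₂ → A)`, `ā ∘ a_J = a`, plus `(ker u → ker p) ∘ (I/𝔪I ≅ ker u) = l_φ`.
[cite: FantechiManetti1999T1Lifting, Lemma 0.3 and proof of Thm. 2.2] [cite: FantechiManetti1998ObstructionCalculus, Prop. 5.3 (iii)]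
[cite: Hartshorne2010, Theorem 11.1] -/
theorem rTensor_toObstructionSpaceJ_ob (hI : I ≤ 𝔪 ^ 2) [Module.Finite k (IModMI k 𝔪 I)]
    {T2' : Type u} [AddCommGroup T2'] [Module k T2']
    (O' : (ArtinFunctor.points (k := k) (P ⧸ I)).ObstructionSpace T2')
    {R₁ R₀ : ArtAlg.{u} k} (p : R₁ →ₐ[k] R₀) (hp : IsSmallExt k p) (a : (P ⧸ I) →ₐ[k] R₀)
    (φ : P →ₐ[k] R₁) (hφ : p.comp φ = a.comp (Ideal.Quotient.mkₐ k I)) (hφJ : ∀ x ∈ J₁, φ x = 0) :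
    (toObstructionSpaceJ hJ hloc hres aug₁ aug₂ O').rTensor (kerₖ k p)
        ((ArtinFunctor.pointsObstructionSpace 𝔪 I hsm hloc hI).ob p hp a) = O'.ob p hp a := by
  have hu := isSmallExt_uJ hJ hloc hres aug₁
  have hφI : ∀ x ∈ I, p (φ x) = 0 := fun x hx => by
    rw [← AlgHom.comp_apply, hφ, AlgHom.comp_apply, Ideal.Quotient.mkₐ_eq_mk, Ideal.Quotient.eq_zero_iff_mem.2 hx,
      map_zero]
  -- `φ` descends to `α : P/J₁ → B` and `p ∘ φ` to `ᾱ : P/J₂ → A`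
  let α : (P ⧸ J₁) →ₐ[k] (R₁ : Type u) := Ideal.Quotient.liftₐ J₁ φ hφJ
  have hJ₂ : ∀ x ∈ J₂, (p.comp φ) x = 0 := fun x hx => by
    obtain ⟨y, hy, z, hz, rfl⟩ := Submodule.mem_sup.1 (hJ.le_sup hx)
    rw [map_add, AlgHom.comp_apply, hφI y hy, AlgHom.comp_apply, hφJ z hz, map_zero, add_zero]
  let ᾱ : (P ⧸ J₂) →ₐ[k] (R₀ : Type u) := Ideal.Quotient.liftₐ J₂ (p.comp φ) hJ₂
  have hcomm : p.comp α = ᾱ.comp (uJ (k := k) hJ) := AlgHom.ext fun x => by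
    obtain ⟨x, rfl⟩ := Ideal.Quotient.mk_surjective x
    rfl
  have hβa : (ArtinFunctor.points (k := k) (P ⧸ I)).map (R := artQuot J₂ aug₂) (S := R₀) ᾱ (aJ hJ) = a :=
    AlgHom.ext fun x => by
      obtain ⟨x, rfl⟩ := Ideal.Quotient.mk_surjective x
      change p (φ x) = a (Ideal.Quotient.mk I x)
      rw [← AlgHom.comp_apply, hφ]
      rfl
  -- Def. 0.1 (ii) for `ob′` along `(α, ᾱ) : u → p`
  have hfun := O'.functorial (R₁ := artQuot J₁ aug₁) (R₀ := artQuot J₂ aug₂) (R₁' := R₁) (R₀' := R₀) (uJ hJ) hu p hp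
    α ᾱ hcomm (aJ hJ)
  rw [hβa] at hfun
  -- `(ker u → ker p) ∘ (I/𝔪I ≅ ker u) = l_φ`
  have hker : kerMap α hcomm ∘ₗ (kerEquivJ hJ hloc hres aug₁).toLinearMap =
      lf p hp φ hφI (hloc R₁ φ) := by
    apply LinearMap.ext
    intro v
    obtain ⟨x, hx, rfl⟩ := cls_surjective 𝔪 I v
    apply Subtype.ext
    rw [LinearMap.comp_apply, coe_kerMap_apply, lf_cls]
    rfl
  -- the model obstruction, read in `Hom(I/𝔪I, K(p))`, is `l_φ`
  have hob : dualTensorHom k (IModMI k 𝔪 I) (kerₖ k p)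
      ((ArtinFunctor.pointsObstructionSpace 𝔪 I hsm hloc hI).ob p hp a) = lf p hp φ hφI (hloc R₁ φ) :=
    dualTensorHom_ob 𝔪 I hsm hloc hI p hp a φ hφ
  rw [hfun, rTensor_eq_lTensor_dualTensorHom (kerEquivJ hJ hloc hres aug₁)
      (O'.ob (R₁ := artQuot J₁ aug₁) (R₀ := artQuot J₂ aug₂) (uJ hJ) hu (aJ hJ))
      (toObstructionSpaceJ hJ hloc hres aug₁ aug₂ O') (fun v => rfl), hob, ← hker, LinearMap.comp_assoc,
    LinearEquiv.comp_coe, LinearEquiv.symm_trans_self, LinearEquiv.refl_toLinearMap, LinearMap.comp_id]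

end Universality

section UniversalityPowerSeries

/-- `P/𝔪_P = k` for `P = k[[x_1, …, x_n]]`. [folklore] -/
private theorem sub_algebraMap_constantCoeff_mem {n : ℕ} (x : MvPowerSeries (Fin n) k) :
    x - algebraMap k (MvPowerSeries (Fin n) k) (MvPowerSeries.constantCoeff x) ∈
      IsLocalRing.maximalIdeal (MvPowerSeries (Fin n) k) := by
  rw [IsLocalRing.mem_maximalIdeal, mem_nonunits_iff, MvPowerSeries.isUnit_iff_constantCoeff, map_sub,
    ← MvPowerSeries.c_eq_algebraMap, MvPowerSeries.constantCoeff_C, sub_self]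
  exact not_isUnit_zero

/-- **[FantechiManetti1999T1Lifting, Lemma 0.3] «canonically», AS PRINTED for `R = k[[x_1, …, x_n]]/I`, `I ⊆ 𝔪²_P`, and
EVERY small extension of `Art_k`**: the canonical injective map `θ : T²_R = (I/𝔪_P I)^∨ → T²` into any obstruction space
`(T², ob′)` of `h_R` (the tree's `ProRep.toObstructionSpaceJ` along [Hartshorne2010, Thm. 11.1]'s truncation
`P/(𝔪_P I + 𝔪ᴺ_P) → P/(I + 𝔪ᴺ_P)`, `N ≥ 1`, `𝔪ᴺ_P ∩ I ⊆ 𝔪_P I` — injective by `ProRep.powerSeries_toObstructionSpaceJ_injective`)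
satisfies `ob′_p(a) = (θ ⊗ K(p))(ob_p(a))` for every small extension `p : B → A` in `Art_k` and every `a ∈ h_R(A)`, where
`ob_p(a) ∈ T²_R ⊗ K(p)` is the model obstruction (`l_φ`, `ArtinFunctor.powerSeriesPointsObstructionSpace`) — i.e.
`(T²_R, ob)` is UNIVERSAL among obstruction spaces of `h_R` ([FantechiManetti1998ObstructionCalculus, Prop. 5.3 (iii)],
in Def. 0.1's language). Proof: `𝔪_B` is nilpotent, so a lifting `φ : P → B` of `a` kills `𝔪_P I + 𝔪^{N′}_P` for
`N′ ≫ N`; `θ` does not depend on the truncation (`ProRep.toObstructionSpaceJ_eq_of_le`); apply `rTensor_toObstructionSpaceJ_ob`.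
[cite: FantechiManetti1999T1Lifting, Lemma 0.3] [cite: FantechiManetti1998ObstructionCalculus, Prop. 5.3 (iii)]
[cite: Hartshorne2010, Theorem 11.1] -/
theorem powerSeries_rTensor_toObstructionSpaceJ_ob {n N : ℕ} (I : Ideal (MvPowerSeries (Fin n) k))
    (hI : I ≤ (IsLocalRing.maximalIdeal (MvPowerSeries (Fin n) k)) ^ 2) (hN : 1 ≤ N)
    (hAR : (IsLocalRing.maximalIdeal (MvPowerSeries (Fin n) k)) ^ N ⊓ I ≤
      IsLocalRing.maximalIdeal (MvPowerSeries (Fin n) k) * I)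
    {T2' : Type u} [AddCommGroup T2'] [Module k T2']
    (O' : (ArtinFunctor.points (k := k) (MvPowerSeries (Fin n) k ⧸ I)).ObstructionSpace T2')
    {R₁ R₀ : ArtAlg.{u} k} (p : R₁ →ₐ[k] R₀) (hp : IsSmallExt k p) (a : (MvPowerSeries (Fin n) k ⧸ I) →ₐ[k] R₀) :
    haveI : IsNoetherianRing (MvPowerSeries (Fin n) k) :=
      Literature.AlgebraicGeometry.Resolution.isNoetherianRing_mvPowerSeries k (Fin n)
    haveI := isLocalRing_quotient _ (sup_pow_ne_top k (IsLocalRing.maximalIdeal _ * I) Ideal.mul_le_right hN)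
    haveI := isArtinianRing_quotient _ (sup_pow_ne_top k (IsLocalRing.maximalIdeal _ * I) Ideal.mul_le_right hN)
      N le_sup_right
    haveI := isLocalRing_quotient _ (sup_pow_ne_top k I (hI.trans (Ideal.pow_le_self two_ne_zero)) hN)
    haveI := isArtinianRing_quotient _ (sup_pow_ne_top k I (hI.trans (Ideal.pow_le_self two_ne_zero)) hN)
      N le_sup_right
    (toObstructionSpaceJ (isTruncation_sup_pow (IsLocalRing.maximalIdeal _) I N hAR)
      (fun S ψ x hx => mvPowerSeries_algHom_mem_maximalIdeal k S ψ x hx)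
      (fun x => ⟨_, sub_algebraMap_constantCoeff_mem k x⟩)
      (quotientAug (mvPowerSeriesAug k n) _
        (sup_pow_ne_top k (IsLocalRing.maximalIdeal _ * I) Ideal.mul_le_right hN))
      (quotientAug (mvPowerSeriesAug k n) _
        (sup_pow_ne_top k I (hI.trans (Ideal.pow_le_self two_ne_zero)) hN)) O').rTensor (kerₖ k p)
      ((ArtinFunctor.powerSeriesPointsObstructionSpace k
        (fun _ _ p hp => points_mvPowerSeries_map_surjective k p hp) I hI).ob p hp a) = O'.ob p hp a := by
  haveI : IsNoetherianRing (MvPowerSeries (Fin n) k) :=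
    Literature.AlgebraicGeometry.Resolution.isNoetherianRing_mvPowerSeries k (Fin n)
  set 𝔪 := IsLocalRing.maximalIdeal (MvPowerSeries (Fin n) k) with h𝔪
  have hI1 : I ≤ 𝔪 := hI.trans (Ideal.pow_le_self two_ne_zero)
  haveI := isLocalRing_quotient _ (sup_pow_ne_top k (𝔪 * I) Ideal.mul_le_right hN)
  haveI := isArtinianRing_quotient _ (sup_pow_ne_top k (𝔪 * I) Ideal.mul_le_right hN) N le_sup_right
  haveI := isLocalRing_quotient _ (sup_pow_ne_top k I hI1 hN)
  haveI := isArtinianRing_quotient _ (sup_pow_ne_top k I hI1 hN) N le_sup_right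
  -- `𝔪_B` is nilpotent: `𝔪_B^M = 0`
  obtain ⟨M, hM⟩ := (isArtinianRing_iff_isNilpotent_maximalIdeal (R₁ : Type u)).1 inferInstance
  -- the deeper truncation `N' = N + M`
  have hN' : 1 ≤ N + M := le_add_right hN
  have hAR' : 𝔪 ^ (N + M) ⊓ I ≤ 𝔪 * I :=
    (inf_le_inf_right I (Ideal.pow_le_pow_right (Nat.le_add_right N M))).trans hAR
  haveI := isLocalRing_quotient _ (sup_pow_ne_top k (𝔪 * I) Ideal.mul_le_right hN')
  haveI := isArtinianRing_quotient _ (sup_pow_ne_top k (𝔪 * I) Ideal.mul_le_right hN') (N + M) le_sup_right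
  haveI := isLocalRing_quotient _ (sup_pow_ne_top k I hI1 hN')
  haveI := isArtinianRing_quotient _ (sup_pow_ne_top k I hI1 hN') (N + M) le_sup_right
  have hJ' := isTruncation_sup_pow 𝔪 I (N + M) hAR'
  -- `θ` at level `N'` equals `θ` at level `N`
  rw [← toObstructionSpaceJ_eq_of_le (isTruncation_sup_pow 𝔪 I N hAR)
    (fun S ψ x hx => mvPowerSeries_algHom_mem_maximalIdeal k S ψ x hx) (fun x => ⟨_, sub_algebraMap_constantCoeff_mem k x⟩)
    (quotientAug (mvPowerSeriesAug k n) _ (sup_pow_ne_top k (𝔪 * I) Ideal.mul_le_right hN))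
    (quotientAug (mvPowerSeriesAug k n) _ (sup_pow_ne_top k I hI1 hN)) hJ'
    (quotientAug (mvPowerSeriesAug k n) _ (sup_pow_ne_top k (𝔪 * I) Ideal.mul_le_right hN'))
    (quotientAug (mvPowerSeriesAug k n) _ (sup_pow_ne_top k I hI1 hN'))
    (sup_le_sup_left (Ideal.pow_le_pow_right (Nat.le_add_right N M)) _)
    (sup_le_sup_left (Ideal.pow_le_pow_right (Nat.le_add_right N M)) _) O']
  -- a lifting `φ : P → B` of `a`; it kills `𝔪I` (small extension) and `𝔪^{N+M}` (`𝔪_B^M = 0`)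
  obtain ⟨φ, hφ⟩ : ∃ φ : MvPowerSeries (Fin n) k →ₐ[k] R₁, p.comp φ = a.comp (Ideal.Quotient.mkₐ k I) :=
    points_mvPowerSeries_map_surjective k (R₁ := R₁) (R₂ := R₀) p hp.surjective (a.comp (Ideal.Quotient.mkₐ k I))
  have hφI : ∀ x ∈ I, p (φ x) = 0 := fun x hx => by
    rw [← AlgHom.comp_apply, hφ, AlgHom.comp_apply, Ideal.Quotient.mkₐ_eq_mk, Ideal.Quotient.eq_zero_iff_mem.2 hx,
      map_zero]
  have hφ𝔪 : Ideal.map φ 𝔪 ≤ IsLocalRing.maximalIdeal (R₁ : Type u) :=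
    Ideal.map_le_iff_le_comap.2 fun x hx => mvPowerSeries_algHom_mem_maximalIdeal k R₁ φ x hx
  have hφJ : ∀ x ∈ 𝔪 * I ⊔ 𝔪 ^ (N + M), φ x = 0 := by
    intro x hx
    obtain ⟨y, hy, z, hz, rfl⟩ := Submodule.mem_sup.1 hx
    have hy0 : φ y = 0 := by
      refine Submodule.mul_induction_on hy (fun m hm w hw => ?_) (fun b c hb hc => ?_)
      · rw [map_mul]
        exact hp.mul_eq_zero_of_mem (mvPowerSeries_algHom_mem_maximalIdeal k R₁ φ m hm) (hφI w hw)
      · rw [map_add, hb, hc, add_zero]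
    have hz0 : φ z = 0 := by
      have h1 : φ z ∈ Ideal.map φ (𝔪 ^ (N + M)) := Ideal.mem_map_of_mem _ hz
      rw [Ideal.map_pow] at h1
      have h2 : (Ideal.map φ 𝔪) ^ (N + M) ≤ IsLocalRing.maximalIdeal (R₁ : Type u) ^ M :=
        (Ideal.pow_right_mono hφ𝔪 _).trans (Ideal.pow_le_pow_right (Nat.le_add_left M N))
      have h3 := h2 h1
      rwa [hM, Submodule.zero_eq_bot, Ideal.mem_bot] at h3
    rw [map_add, hy0, hz0, add_zero]
  haveI := finite_IModMI_mvPowerSeries k I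
  exact rTensor_toObstructionSpaceJ_ob hJ' (fun _ _ q hq ψ => points_mvPowerSeries_map_surjective k q hq ψ)
    (fun S ψ x hx => mvPowerSeries_algHom_mem_maximalIdeal k S ψ x hx) (fun x => ⟨_, sub_algebraMap_constantCoeff_mem k x⟩)
    _ _ hI O' p hp a φ hφ hφJ

end UniversalityPowerSeries

/-! ### §7. THEOREM 2.2, modulo the curve selection lemma 2.4 alone -/

/-- **[FantechiManetti1999T1Lifting, THEOREM 2.2] FOR A FUNCTOR WITH A GIVEN HULL, MODULO LEMMA 2.4** (p. 5–6:
«THEOREM 2.2. Let `F` be a deformation functor, and let `T^{2c}_F` be the vector subspace of `T²_F` generated by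
curvilinear obstructions. If `k` is algebraically closed, then the dimension of the hull of `F` is
`≥ dim T¹_F − dim T^{2c}_F`. … Proof of theorem 2.2. Let `h_R → F` be a smooth morphism (that is, `R` is a hull for
`F`). Then `T²_F` is naturally an obstruction space for `h_R`, hence by 0.3 it contains `T²_R` as a vector subspace
and `T^{2c}_F = T^{2c}_R`. The theorem follows from proposition 2.5. □»): for `R = k[[x_1, …, x_n]]/I`, `I ⊆ 𝔪²`, a
functor of Artin rings `F` with a finite-dimensional obstruction space `(T²_F, ob^F)` (Def. 0.1) and a morphism
`ν : h_R → F` SMOOTH on small extensions (the printed «hull», minus the tangent bijection, which is not used), and the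
data of Prop. 2.5's proof for `R` (arcs as in 2), `I ⊆ √(f_1, …, f_h)` — what Lemma 2.4 produces when `k = k̄`):
`n ≤ dim R + dim_k T^{2c}_F`. Every printed step is now a tree theorem: «`T²_F` is naturally an obstruction space for
`h_R`» = `ArtinFunctor.ObstructionTheory.comap` + `comap_isComplete_of_isSmoothMapSmall` (`CompatibleObstructionTheories.lean`);
«by 0.3 it contains `T²_R` as a vector subspace» = `ProRep.powerSeries_toObstructionSpaceJ_injective`
(`T1LiftingAuxiliaryAlgebras.lean`); «and `T^{2c}_F = T^{2c}_R`» (the inclusion `⊇`, which is what is used) = §6's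
universality `powerSeries_rTensor_toObstructionSpaceJ_ob` + §5; «The theorem follows from proposition 2.5» = §4.
[cite: FantechiManetti1999T1Lifting, Thm. 2.2] -/
theorem powerSeries_le_ringKrullDim_add_finrank_span_curvilinearObstructions_of_isSmoothMapSmall_of_arcs {n : ℕ}
    (I : Ideal (MvPowerSeries (Fin n) k)) (hI : I ≤ (IsLocalRing.maximalIdeal (MvPowerSeries (Fin n) k)) ^ 2)
    (F : ArtinFunctor.{u} k) {W : Type u} [AddCommGroup W] [Module k W] [Module.Finite k W]
    (OF : F.ObstructionSpace W)
    (ν : ∀ R : ArtAlg.{u} k, (ArtinFunctor.points (k := k) (MvPowerSeries (Fin n) k ⧸ I)).obj R → F.obj R)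
    (hν : (ArtinFunctor.points (k := k) (MvPowerSeries (Fin n) k ⧸ I)).IsNatural F ν)
    (hs : (ArtinFunctor.points (k := k) (MvPowerSeries (Fin n) k ⧸ I)).IsSmoothMapSmall F ν)
    {h : ℕ} (f : Fin h → MvPowerSeries (Fin n) k) (hfI : ∀ i, f i ∈ I)
    (hIrad : I ≤ (Ideal.span (Set.range f)).radical)
    (φ : Fin h → (MvPowerSeries (Fin n) k →ₐ[k] PowerSeries k)) (p : Fin h → ℕ)
    (hφI : ∀ i, ∀ g ∈ I, ∀ d < p i, PowerSeries.coeff d (φ i g) = 0)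
    (hφlow : ∀ i j : Fin h, j < i → φ i (f j) = 0)
    (hφdiag : ∀ i, PowerSeries.coeff (p i) (φ i (f i)) ≠ 0) :
    (n : WithBot ℕ∞) ≤ ringKrullDim (MvPowerSeries (Fin n) k ⧸ I) +
      Module.finrank k (Submodule.span k OF.curvilinearObstructions) := by
  -- «T²_F is naturally an obstruction space for h_R»
  let O' : (ArtinFunctor.points (k := k) (MvPowerSeries (Fin n) k ⧸ I)).ObstructionSpace W :=
    (OF.toObstructionTheory.comap ν hν).toObstructionSpace
      (OF.toObstructionTheory.comap_isComplete_of_isSmoothMapSmall OF.toObstructionTheory_isComplete ν hν hs)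
  have hO' : ∀ {R₁ R₀ : ArtAlg.{u} k} (q : R₁ →ₐ[k] R₀) (hq : IsSmallExt k q)
      (a : (ArtinFunctor.points (k := k) (MvPowerSeries (Fin n) k ⧸ I)).obj R₀), O'.ob q hq a = OF.ob q hq (ν _ a) :=
    fun _ _ _ => rfl
  -- «hence by 0.3 it contains T²_R as a vector subspace»
  obtain ⟨N, hN, hAR⟩ := exists_pow_inf_le_maximalIdeal_mul k I
  have hinj := powerSeries_toObstructionSpaceJ_injective k I hI hN hAR O'
  -- «and T^{2c}_F = T^{2c}_R» (⊇, from universality) — «The theorem follows from proposition 2.5»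
  refine powerSeries_le_ringKrullDim_add_finrank_span_curvilinearObstructions_of_compatible_of_arcs k I hI F OF ν _
    hinj (fun N' a => ?_) f hfI hIrad φ p hφI hφlow hφdiag
  have huniv := powerSeries_rTensor_toObstructionSpaceJ_ob k I hI hN hAR O' (R₁ := artA k (N' + 1))
    (R₀ := artA k N') (i k N') (isSmallExtension_i k N').isSmallExt a
  rw [hO'] at huniv
  exact huniv.symm

/-- **«hence by 0.3 it contains `T²_R` as a vector subspace and `T^{2c}_F = T^{2c}_R`» AS PRINTED**, for `R = P/I`,
`I ⊆ 𝔪²`, a functor `F` with an obstruction space `(T²_F, ob^F)` and `ν : h_R → F` natural, smooth on small extensions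
and SURJECTIVE on the `A_N` (a smooth morphism out of a hull is surjective on objects, `IsSmoothMap.surjective_of_surjective`;
taken as a hypothesis): there is an injective `θ : T²_R → T²_F` (Lemma 0.3's) under which the curvilinear obstructions
of the model `(T²_R, l_•)` correspond EXACTLY to those of `F`. [cite: FantechiManetti1999T1Lifting, Thm. 2.2 (proof)] -/
theorem powerSeries_exists_injective_image_curvilinearObstructions_eq {n : ℕ}
    (I : Ideal (MvPowerSeries (Fin n) k)) (hI : I ≤ (IsLocalRing.maximalIdeal (MvPowerSeries (Fin n) k)) ^ 2)
    (F : ArtinFunctor.{u} k) {W : Type u} [AddCommGroup W] [Module k W] (OF : F.ObstructionSpace W)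
    (ν : ∀ R : ArtAlg.{u} k, (ArtinFunctor.points (k := k) (MvPowerSeries (Fin n) k ⧸ I)).obj R → F.obj R)
    (hν : (ArtinFunctor.points (k := k) (MvPowerSeries (Fin n) k ⧸ I)).IsNatural F ν)
    (hs : (ArtinFunctor.points (k := k) (MvPowerSeries (Fin n) k ⧸ I)).IsSmoothMapSmall F ν)
    (hsurj : ∀ N : ℕ, Function.Surjective (ν (artA k N))) :
    ∃ θ : Module.Dual k (IModMI k (IsLocalRing.maximalIdeal (MvPowerSeries (Fin n) k)) I) →ₗ[k] W,
      Function.Injective θ ∧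
        θ '' (ArtinFunctor.powerSeriesPointsObstructionSpace k
          (fun _ _ p hp => points_mvPowerSeries_map_surjective k p hp) I hI).curvilinearObstructions =
          OF.curvilinearObstructions := by
  let O' : (ArtinFunctor.points (k := k) (MvPowerSeries (Fin n) k ⧸ I)).ObstructionSpace W :=
    (OF.toObstructionTheory.comap ν hν).toObstructionSpace
      (OF.toObstructionTheory.comap_isComplete_of_isSmoothMapSmall OF.toObstructionTheory_isComplete ν hν hs)
  have hO' : ∀ {R₁ R₀ : ArtAlg.{u} k} (q : R₁ →ₐ[k] R₀) (hq : IsSmallExt k q)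
      (a : (ArtinFunctor.points (k := k) (MvPowerSeries (Fin n) k ⧸ I)).obj R₀), O'.ob q hq a = OF.ob q hq (ν _ a) :=
    fun _ _ _ => rfl
  obtain ⟨N, hN, hAR⟩ := exists_pow_inf_le_maximalIdeal_mul k I
  refine ⟨_, powerSeries_toObstructionSpaceJ_injective k I hI hN hAR O',
    image_curvilinearObstructions_eq_of_compatible _ OF ν _ (fun N' a => ?_) hsurj⟩
  have huniv := powerSeries_rTensor_toObstructionSpaceJ_ob k I hI hN hAR O' (R₁ := artA k (N' + 1))
    (R₀ := artA k N') (i k N') (isSmallExtension_i k N').isSmallExt a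
  rw [hO'] at huniv
  exact huniv.symm

end ProRep

end Literature.AlgebraicGeometry.Deformation
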